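import Summits.Ventures.HSemireg.WedgeHankelRecurrenceDual
import Mathlib.RingTheory.AdjoinRoot

/-!
# Venture HSemireg — THE PERIODS OF A RATIONAL CLASS: for a monic `m` and a residue `a`, **the dual class `dualSeq m a` (the moment sequence of `a/m`) is `T`-periodic iff `m ∣ (X^T − 1)·a`;
# for `a` prime to `m` iff `m ∣ X^T − 1`, i.e. iff `x^T = 1` in `K[X]/(m)` — so its periods are exactly the multiples of the multiplicative order of `x = X mod m`**
# («the period of an LFSR sequence is the order of its connection polynomial»)

HONEST FRAMING. Part of the Lean index of the computation cell `pub-hsemireg` (seat p10 gen 30, Sunday typer «UNIFORM-IN-n»).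
LINEAR ALGEBRA OF HANKEL (catalecticant) MATRICES and of polynomials over a field ONLY (`Polynomial.modByMonic`, `AdjoinRoot`): no variety, no cohomology theory, no sheaf, no Ext group
and no semiregularity map is constructed here; nothing here says that HC / HC_CM / HC_AV holds; no Literature fact is declared or used.  Custodian versions as in `WedgeHankelSiegelIdeal`
(1/3); the dictionary («the least period of a linear recurring sequence with unit numerator is `ord(m)`, the order of `X` in `(F_q[X]/(m))ˣ`», Lidl–Niederreiter Ch. 8) is QUOTED in docstrings,
never asserted — periods are stated through `Function.Periodic` and `orderOf (AdjoinRoot.root m)` (which is `0` when `x` has infinite or no order, e.g. `X ∣ m`).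

WHAT IS IN THE TREE.  N32 (`WedgeHankelRecurrenceDual`, № 263): `dualSeq`, `dualSeq_X_pow_mul` (`dualSeq m (X^T a) j = dualSeq m a (j + T)`), `dualSeq_add`, `dualSeq_smul`, `dualSeq_modByMonic`,
`dualSeq_eq_zero_of_dvd`, `eq_zero_of_dualSeq_eq_zero`.  Mathlib: `Function.Periodic`, `Polynomial.modByMonic_eq_zero_iff_dvd`, `Polynomial.natDegree_modByMonic_lt`, `IsCoprime.dvd_of_dvd_mul_right`,
`AdjoinRoot.mk_eq_zero`, `orderOf_dvd_iff_pow_eq_one`.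
THIS FILE (namespace `Summit.Ventures.HSemireg.Wedge.HankelOuter` continued; PLAIN on N32 (+ `Mathlib.RingTheory.AdjoinRoot`); 0 definitions):
* §638 **`dualSeq_eq_zero_iff_dvd`** (`dualSeq m b = 0 ↔ m ∣ b`), `dualSeq_sub`, **`periodic_dualSeq_iff_dvd_mul`** (`T`-periodic ↔ `m ∣ (X^T − 1)·a`), **`periodic_dualSeq_iff_dvd`** (`gcd(m, a) = 1`:
  ↔ `m ∣ X^T − 1`), **`periodic_dualSeq_iff_pow_root_eq_one`** (↔ `(AdjoinRoot.root m)^T = 1`), **`periodic_dualSeq_iff_orderOf_dvd`** (↔ `orderOf (AdjoinRoot.root m) ∣ T`: THE PERIODS ARE THE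
  MULTIPLES OF THE ORDER OF `x`), `periodic_dualSeq_orderOf` (the order itself is a period).
Nothing Ext-side.  New names only.
-/

open Module Polynomial
open scoped Matrix Polynomial

namespace Summit.Ventures.HSemireg.Wedge.HankelOuter

open Summit.Ventures.HSemireg.Wedge Summit.Ventures.HSemireg.Wedge.Hankel

variable (K : Type*) [Field K]

/-! ## §638. Periods of a dual class -/

/-- **`dualSeq m b = 0 ↔ m ∣ b`** (`m` monic): the dual class of `b` vanishes identically iff `b ≡ 0 mod m` (N32's non-degeneracy on the residue `b mod m`). -/
theorem dualSeq_eq_zero_iff_dvd {m : K[X]} (hm : m.Monic) (b : K[X]) : dualSeq K m b = 0 ↔ m ∣ b := by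
  refine ⟨fun h => ?_, dualSeq_eq_zero_of_dvd K hm⟩
  rcases eq_or_ne m 1 with rfl | hm1
  · exact one_dvd b
  rw [← Polynomial.modByMonic_eq_zero_iff_dvd hm]
  refine eq_zero_of_dualSeq_eq_zero K hm (Polynomial.natDegree_modByMonic_lt b hm hm1) fun j _ => ?_
  rw [dualSeq_modByMonic K hm, h, Pi.zero_apply]

/-- `dualSeq m (a − b) = dualSeq m a − dualSeq m b`. -/
theorem dualSeq_sub (m a b : K[X]) : dualSeq K m (a - b) = dualSeq K m a - dualSeq K m b := by
  rw [sub_eq_add_neg, dualSeq_add, ← neg_one_smul K b, dualSeq_smul, neg_one_smul, sub_eq_add_neg]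

/-- **`dualSeq m a` IS `T`-PERIODIC IFF `m ∣ (X^T − 1)·a`** (`m` monic; the shift by `T` is multiplication of the residue by `X^T`, N32). -/
theorem periodic_dualSeq_iff_dvd_mul {m : K[X]} (hm : m.Monic) (a : K[X]) (T : ℕ) : Function.Periodic (dualSeq K m a) T ↔ m ∣ (Polynomial.X ^ T - 1) * a := by
  have key : Function.Periodic (dualSeq K m a) T ↔ dualSeq K m (Polynomial.X ^ T * a) = dualSeq K m a := by
    constructor
    · intro h; funext j; rw [dualSeq_X_pow_mul]; exact h j
    · intro h j; rw [← dualSeq_X_pow_mul, h]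
  rw [key, ← sub_eq_zero, ← dualSeq_sub, dualSeq_eq_zero_iff_dvd K hm, sub_mul, one_mul]

/-- **FOR A RESIDUE PRIME TO `m`: `dualSeq m a` is `T`-periodic iff `m ∣ X^T − 1`.** -/
theorem periodic_dualSeq_iff_dvd {m a : K[X]} (hm : m.Monic) (hcop : IsCoprime m a) (T : ℕ) : Function.Periodic (dualSeq K m a) T ↔ m ∣ Polynomial.X ^ T - 1 := by
  rw [periodic_dualSeq_iff_dvd_mul K hm]
  exact ⟨fun h => hcop.dvd_of_dvd_mul_right h, fun h => dvd_mul_of_dvd_left h a⟩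

/-- **… iff `x^T = 1` in `K[X]/(m)`** (`x = AdjoinRoot.root m`). -/
theorem periodic_dualSeq_iff_pow_root_eq_one {m a : K[X]} (hm : m.Monic) (hcop : IsCoprime m a) (T : ℕ) : Function.Periodic (dualSeq K m a) T ↔ AdjoinRoot.root m ^ T = 1 := by
  rw [periodic_dualSeq_iff_dvd K hm hcop, ← AdjoinRoot.mk_eq_zero, map_sub, map_pow, AdjoinRoot.mk_X, map_one, sub_eq_zero]

/-- **THE PERIODS ARE THE MULTIPLES OF THE ORDER OF `x`: `dualSeq m a` (`gcd(m, a) = 1`) is `T`-periodic iff `orderOf (AdjoinRoot.root m) ∣ T`** (when `x` has no finite order — e.g. `X ∣ m` or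
`K` infinite and `m` with a root of infinite order — `orderOf = 0` and the only period is `0`). -/
theorem periodic_dualSeq_iff_orderOf_dvd {m a : K[X]} (hm : m.Monic) (hcop : IsCoprime m a) (T : ℕ) : Function.Periodic (dualSeq K m a) T ↔ orderOf (AdjoinRoot.root m) ∣ T := by
  rw [periodic_dualSeq_iff_pow_root_eq_one K hm hcop, orderOf_dvd_iff_pow_eq_one]

/-- in particular the order of `x` is a period. -/
theorem periodic_dualSeq_orderOf {m a : K[X]} (hm : m.Monic) (hcop : IsCoprime m a) : Function.Periodic (dualSeq K m a) (orderOf (AdjoinRoot.root m)) :=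
  (periodic_dualSeq_iff_orderOf_dvd K hm hcop _).mpr (dvd_refl _)

end Summit.Ventures.HSemireg.Wedge.HankelOuter
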